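import Mathlib.RingTheory.MvPolynomial.Basic
import Mathlib.Data.Fin.VecNotation
import Literature.AlgebraicGeometry.Hironaka2017.EdgeInvOfSubalgebra
import Literature.AlgebraicGeometry.Hironaka2017.S04CharAlgebra.R007aInv
import Summits.ResolutionOfSingularities.ResolutionOfSingularities.Theorems.MarkedTransferCampaignW31InvOrderConvention
import HarnessLib

/-!
# Kill test K3.1 (LADDER-RESOLUTION rung L, slot W3.1): the two edge algebras of the specimen `Ê = (y² − x²z² + x⁵, 2)`
# (char `3`) as tree `EdgeAlgebra.Presentation`s and their typed `Inv` values (test T2 of `L/res-L1-k31/PREREG-K3.1.md`)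

Cell `res-hironaka`, seat `res-L1-k31`; companion of `MarkedTransferCampaignW31InvOrderConvention.lean` (p461082: the ORDER CONVENTION,
test T1) and `MarkedTransferCampaignW31QuinticEdgeData.lean` (polynomial certificates, test T3). HONEST FRAMING: «[OURS · L1 W3.1]
kill-test helper; NOT a statement of the manuscript.» The identification of the edge algebras of `Ê` — `K[x̄, ȳ] ⊆ K[x̄, ȳ, z̄]` at a
general closed point `Q` of the axis `Sing(Ê)` and `K[ȳ]` at the origin `O` — is the hand argument of `L/res-L1-k31/KILL-TEST-K3.1.md`
§3 over the manuscript's definitions (geometric `℘` p.17 l.1–3, Def. 4.9 p.20, Def. 4.11 p.21 of [Hironaka2017], quoted for locators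
only; [claim: Hironaka2017, status: under-review]); what is kernel-checked HERE is the bookkeeping from those two algebras to the
typed values of Eq. (34):

* `toEdgeInv_adjoin_axis` — EVERY presentation (tree `Literature.AlgebraicGeometry.Hironaka2017.EdgeAlgebra.Presentation`: powers
  of independent linear forms with sorted `p`-power exponents; the number `r` of generators and the exponents are intrinsic,
  `Presentation.toEdgeInv_eq`) of `K[x̄, ȳ]` has edge datum `q = (1, 1)`, i.e. the typed value
  `S04CharAlgebra.invOfExponents 3 [1, 1]` = `(3, 1, 1, 1)`; `nonempty_presentation_axis` — one exists.
* `toEdgeInv_adjoin_origin` — every presentation of `K[ȳ]` has `q = (1)`, typed value `invOfExponents 3 [1]` = `(3, 2, 1)`;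
  `nonempty_presentation_origin`.
* `toEdgeInv_axis_lt_origin` — hence, by p461082's `InvOrderConvention.inv_axis_lt_inv_origin`, the origin's value is the LARGER:
  an INCREASE of the typed `Inv` under the specialisation `Q ⤳ O`, for every choice of presentations.

Host item: MarkedTransfer `HypersurfaceOrderReduction` (stmt-ResolutionOfSingularities-16155), as for p461082. No new route, no new item.

## References
* H. Hironaka, ms. 2017-03-23 [Hironaka2017]: Rem. 4.7 / Def. 4.9 p.20, Def. 4.11 / Eq. (28) p.21, Eq. (34) p.24 — locators only.
* H. Hironaka, *Additive groups associated with points of a projective space*, Ann. of Math. 92 (1970) 327–334 — the structure of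
  Diff-stable graded algebras behind `EdgeAlgebra.Presentation` (tree `Resolution.exists_eq_adjoin_pow_linearForms_of_isDiffStable`).
-/

set_option linter.dupNamespace false -- mandated namespace of this single-conjunct summit

noncomputable section

namespace Summit.ResolutionOfSingularities.ResolutionOfSingularities.Theorems.QuinticEdgeAlgebras

open MvPolynomial
open Literature.AlgebraicGeometry.Hironaka2017.Datum
open Literature.AlgebraicGeometry.Hironaka2017.S04CharAlgebra
open Literature.AlgebraicGeometry.Hironaka2017.EdgeAlgebra

/-! ## §5 (T2) The typed `Inv` values of the two edge algebras `K[x̄, ȳ]` and `K[ȳ]` -/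

section Presentations

variable {K : Type*} [Field K] (p : ℕ) [ExpChar K p]

/-- Two `EdgeInv` values with the same exponent list are equal. [OURS · L1 W3.1] elementary; NOT a statement of the manuscript. -/
theorem edgeInv_eq_of_q_eq {n : ℕ} {v w : EdgeInv n} (h : v.q = w.q) : v = w := by
  cases v; cases w; cases h; rfl

/-- **Edge algebra of the general axis point.** Every presentation (tree `EdgeAlgebra.Presentation`: powers of independent linear forms,
sorted `p`-power exponents; the number of generators is intrinsic, `Presentation.toEdgeInv_eq`) of the subalgebra
`K[x̄, ȳ] ⊆ K[x̄, ȳ, z̄]` has edge datum `q = (1, 1)`, i.e. the typed value `invOfExponents 3 [1, 1]` = `(3, 1, 1, 1)` of Eq. (34).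
[OURS · L1 W3.1] kill-test helper; NOT a statement of the manuscript. -/
theorem toEdgeInv_adjoin_axis (h₁ : [1, 1].length ≤ 3) (h₂ : ∀ x ∈ [1, 1], 1 ≤ x)
    (P : Presentation p (Algebra.adjoin K ({X 0, X 1} : Set (MvPolynomial (Fin 3) K)))) :
    P.toEdgeInv = invOfExponents 3 [1, 1] h₁ h₂ := by
  let P₀ : Presentation p (Algebra.adjoin K ({X 0, X 1} : Set (MvPolynomial (Fin 3) K))) :=
    { r := 2
      form := ![X 0, X 1]
      expo := fun _ => 0
      mem_span := by
        intro j; fin_cases j <;> exact Submodule.subset_span ⟨_, rfl⟩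
      linearIndependent := by
        have h := (MvPolynomial.linearIndependent_X (Fin 3) K).comp ![(0 : Fin 3), 1]
          (by intro i j hij; fin_cases i <;> fin_cases j <;> simp_all)
        have e : (![X 0, X 1] : Fin 2 → MvPolynomial (Fin 3) K) = X ∘ ![(0 : Fin 3), 1] := by
          funext j; fin_cases j <;> rfl
        rw [e]; exact h
      monotone := fun _ _ _ => le_rfl
      eq_adjoin := by
        congr 1
        ext v
        simp only [pow_zero, pow_one, Set.mem_insert_iff, Set.mem_singleton_iff, Set.mem_range]
        constructor
        · rintro (rfl | rfl)
          · exact ⟨0, rfl⟩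
          · exact ⟨1, rfl⟩
        · rintro ⟨j, rfl⟩
          fin_cases j
          · exact Or.inl rfl
          · exact Or.inr rfl }
  rw [Presentation.toEdgeInv_eq P P₀]
  apply edgeInv_eq_of_q_eq
  show List.ofFn P₀.q = [1, 1]
  simp [Presentation.q, P₀, List.ofFn_succ]

omit [ExpChar K p] in
/-- `K[x̄, ȳ]` admits a presentation (so `toEdgeInv_adjoin_axis` is not vacuous). [OURS · L1 W3.1] kill-test helper; NOT a statement of
the manuscript. -/
theorem nonempty_presentation_axis :
    Nonempty (Presentation p (Algebra.adjoin K ({X 0, X 1} : Set (MvPolynomial (Fin 3) K)))) :=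
  ⟨{ r := 2
     form := ![X 0, X 1]
     expo := fun _ => 0
     mem_span := by
       intro j; fin_cases j <;> exact Submodule.subset_span ⟨_, rfl⟩
     linearIndependent := by
       have h := (MvPolynomial.linearIndependent_X (Fin 3) K).comp ![(0 : Fin 3), 1]
         (by intro i j hij; fin_cases i <;> fin_cases j <;> simp_all)
       have e : (![X 0, X 1] : Fin 2 → MvPolynomial (Fin 3) K) = X ∘ ![(0 : Fin 3), 1] := by
         funext j; fin_cases j <;> rfl
       rw [e]; exact h
     monotone := fun _ _ _ => le_rfl
     eq_adjoin := by
       congr 1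
       ext v
       simp only [pow_zero, pow_one, Set.mem_insert_iff, Set.mem_singleton_iff, Set.mem_range]
       constructor
       · rintro (rfl | rfl)
         · exact ⟨0, rfl⟩
         · exact ⟨1, rfl⟩
       · rintro ⟨j, rfl⟩
         fin_cases j
         · exact Or.inl rfl
         · exact Or.inr rfl }⟩

/-- **Edge algebra of the origin.** Every presentation of `K[ȳ] ⊆ K[x̄, ȳ, z̄]` has edge datum `q = (1)`, i.e. the typed value
`invOfExponents 3 [1]` = `(3, 2, 1)`. [OURS · L1 W3.1] kill-test helper; NOT a statement of the manuscript. -/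
theorem toEdgeInv_adjoin_origin (h₃ : [1].length ≤ 3) (h₄ : ∀ x ∈ [1], 1 ≤ x)
    (P : Presentation p (Algebra.adjoin K ({X 1} : Set (MvPolynomial (Fin 3) K)))) :
    P.toEdgeInv = invOfExponents 3 [1] h₃ h₄ := by
  let P₀ : Presentation p (Algebra.adjoin K ({X 1} : Set (MvPolynomial (Fin 3) K))) :=
    { r := 1
      form := ![X 1]
      expo := fun _ => 0
      mem_span := by
        intro j; fin_cases j; exact Submodule.subset_span ⟨_, rfl⟩
      linearIndependent := by
        have h := (MvPolynomial.linearIndependent_X (Fin 3) K).comp ![(1 : Fin 3)]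
          (by intro i j _; fin_cases i; fin_cases j; rfl)
        have e : (![X 1] : Fin 1 → MvPolynomial (Fin 3) K) = X ∘ ![(1 : Fin 3)] := by
          funext j; fin_cases j; rfl
        rw [e]; exact h
      monotone := fun _ _ _ => le_rfl
      eq_adjoin := by
        congr 1
        ext v
        simp only [pow_zero, pow_one, Set.mem_singleton_iff, Set.mem_range]
        constructor
        · rintro rfl; exact ⟨0, rfl⟩
        · rintro ⟨j, rfl⟩; fin_cases j; rfl }
  rw [Presentation.toEdgeInv_eq P P₀]
  apply edgeInv_eq_of_q_eq
  show List.ofFn P₀.q = [1]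
  simp [Presentation.q, P₀, List.ofFn_succ]

omit [ExpChar K p] in
/-- `K[ȳ]` admits a presentation. [OURS · L1 W3.1] kill-test helper; NOT a statement of the manuscript. -/
theorem nonempty_presentation_origin :
    Nonempty (Presentation p (Algebra.adjoin K ({X 1} : Set (MvPolynomial (Fin 3) K)))) :=
  ⟨{ r := 1
     form := ![X 1]
     expo := fun _ => 0
     mem_span := by
       intro j; fin_cases j; exact Submodule.subset_span ⟨_, rfl⟩
     linearIndependent := by
       have h := (MvPolynomial.linearIndependent_X (Fin 3) K).comp ![(1 : Fin 3)]
         (by intro i j _; fin_cases i; fin_cases j; rfl)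
       have e : (![X 1] : Fin 1 → MvPolynomial (Fin 3) K) = X ∘ ![(1 : Fin 3)] := by
         funext j; fin_cases j; rfl
       rw [e]; exact h
     monotone := fun _ _ _ => le_rfl
     eq_adjoin := by
       congr 1
       ext v
       simp only [pow_zero, pow_one, Set.mem_singleton_iff, Set.mem_range]
       constructor
       · rintro rfl; exact ⟨0, rfl⟩
       · rintro ⟨j, rfl⟩; fin_cases j; rfl }⟩

/-- **K3.1 on actual algebras: the edge datum of `K[x̄, ȳ]` (general axis point) is STRICTLY BELOW that of `K[ȳ]` (origin) in the typed
order** — `(3,1,1,1) <lex (3,2,1)`: the special point carries the LARGER `Inv`, an INCREASE under specialisation `Q ⤳ O`, for every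
choice of presentations. [OURS · L1 W3.1] kill-test helper; NOT a statement of the manuscript. -/
theorem toEdgeInv_axis_lt_origin
    (P : Presentation p (Algebra.adjoin K ({X 0, X 1} : Set (MvPolynomial (Fin 3) K))))
    (Q : Presentation p (Algebra.adjoin K ({X 1} : Set (MvPolynomial (Fin 3) K)))) :
    P.toEdgeInv < Q.toEdgeInv := by
  rw [toEdgeInv_adjoin_axis p (by decide) (by decide) P, toEdgeInv_adjoin_origin p (by decide) (by decide) Q]
  exact InvOrderConvention.inv_axis_lt_inv_origin _ _ _ _

end Presentations

end Summit.ResolutionOfSingularities.ResolutionOfSingularities.Theorems.QuinticEdgeAlgebras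

end
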